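import Literature.MathematicalPhysics.QuantumFieldTheory.Balaban1983to89.Node00.ShearedAveragingPureGauge
import Literature.MathematicalPhysics.QuantumFieldTheory.Balaban1983to89.Node00.ShearedAveragingRecord

/-!
# NODE 00 — the hinge `𝒜_j(1^g) = 1^{R̄ʲg}` of `Node00.ShearedAveragingPureGauge` and road R0′'s naming row (r0) AT THE RECORD: the printed
# `exp[mean log]` on `SU(N)` satisfies (0.5)∕(0.6) on ALL families, so every hypothesis of n07-e's file 1b is discharged at `avOfRecord` ∕
# `contourOfRecord` ∕ the (78) block operation of record — def-free sequel of `Node00.ShearedAveragingRecord`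

Cell `pub-ymgap` (HUMAN RULINGS D-0062 ∕ D-0088 ∕ D-0149), width seat `pub-ymgap-dag-n07-w6` g0 (second wave; lane owner dag-n07-e g19's WORD-W6 (3) ∕ bus I.29566 «record
instance: the SAME three discharges as for file 1 + `(av i).avg 1 = 1` + the two inner-operation axioms (0.5)∕(0.6) for your base-point-factored eml on its domain — choose a total
extension … or carry the guard»), 2026-08-28.  `--kind proof --supports stmt-QuantumFields-20542` (K1⁷; count-neutral helper).  Companion of n07-e's `Node00.ShearedAveragingPureGauge`
(ITEM R4 file 1b, the group-level hinge behind dag-n07-w7's ROAD-CHECK (A)) and of this seat's `Node00.ShearedAveragingRecord` (p608036, the record instance of file 1).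

THE PRINT.  [3] = T. Bałaban, *Averaging operations for lattice gauge theories*, Commun. Math. Phys. **98** (1985) 17–51 `[Balaban1985Averaging]`, (78)–(80) p. 30, (85)–(88)
p. 31 (READ AS IMAGES, renders `…/1985-cmp98-averaging-p014-x2.png`, `-p015-x2.png`); [I] = [Balaban1987RG1] p. 253: (0.4) the averaging of record and the axioms «M({U_j⁻¹}) =
M({U_j})⁻¹; (0.5) M({uU_jv}) = uM({U_j})v; (0.6)» imposed «on sets {U_j} … with sufficiently small diameters»; [B11] = [Balaban1985Variational] (154)–(156) p. 302.

WHAT THIS FILE DOES (exact group algebra ∕ bookkeeping; NOTHING of [3] Sect. 3, [B11] Sect. F or [6] is proved or asserted).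
* §1 THE TOTAL EXTENSION IS ALREADY IN THE TREE: `ExpMeanLog.ESU` (the inner operation of `expMeanLogSU`) is «`exp[mean log]` on the guard `∀ i, ‖W_i − 1‖ < δ_N`, `1` off it»
  (`ESU_of_not_small`), and the guard is invariant under `W ↦ W⁻¹` (`norm_star_sub_one`) and `W ↦ uWu⁻¹` (`norm_conj_sub_one_eq`); hence (0.5) and (0.6) (constant conjugations)
  hold on EVERY family: `ESU_inv_total`, `ESU_conj_total`, and for `LoopAverage.avg` over any nonempty finite index type `expMeanLogSU_avg_inv_total` ∕ `…_conj_total`.  No new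
  extension is chosen and no guard is carried.
* §2 n07-e's hypotheses at the record's letters: ★ `loopAvgBlockOp_inv` ∕ ★ `loopAvgBlockOp_conj` (= `hinv` ∕ `hconj` for the (78) block operation `loopAvgBlockOp expMeanLogSU` of
  `Node00.ShearedAveragingRecord`, every level, no guard), `avOfRecord_avg_one` (= `h1`: `M(1) = 1` for `avOfRecord`, `T3DescentFibreTower.avgFun_one`); `hcd1` is
  `Node00.holTo_contourOfRecord_one` (p608036).
* §3 THE INSTANCE: ★★ `shearRIter_avOfRecord_pureGauge` (`S_j(1^g) = g↾T^{(j)}·(R̄ʲg)⁻¹`), ★★★ `shearedAvgIter_avOfRecord_pureGauge` — **`𝒜_j(1^g) = 1^{R̄ʲg}` at `avOfRecord` ∕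
  `contourOfRecord` ∕ `exp[mean log]` for EVERY fine gauge function `g` and every `j ≤ m + K`, unconditionally** — `shearedAvg_avOfRecord_pureGauge` (one step); ★★ road R0′'s NAMING
  ROW (r0) AT THE RECORD (plan g83 WORDS-2, cell bus I.29399) `iter_avOfRecord_eq_gaugeAct_shearRIter` ∕ `…_data` ∕ `…_cubeDomains`: under the block axial gauges of `M^i(U′)`, `i < j`,
  and the (81)∕(1.29) normalisation at both ends of `c` (resp. on the `Λ_j`-sites of `Node00.cubeDomains`), `M^j(U₁)(c) = S_j(c₋)·M^j(U′)(c)·S_j(c₊)⁻¹ = S_j(c₋)·V″(c)·S_j(c₊)⁻¹` — the sheared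
  datum of road R0 written through the INTRINSIC coarse gauge `S_j(U₁)` of record; ★ A6 non-vacuity `shearedAvgIter_avOfRecord_pureGauge_one`.

HONEST FRAMING (binding).  Count-neutral helper; def-free; by-name compositions of landed theorems (n07-e `ShearedAveragingFlat` p607232 ∕ `ShearedAveragingPureGauge`, this seat's
`ShearedAveragingRecord` p608036, b2b `BlockAveragingExpMeanLog` ∕ `T3DescentFibreTower`).  The axial gauges of `M^i(U′)` and the (1.29) normalisation are HYPOTHESES ([B11] Sect. F's
set-up ∕ [6] Thm 2 — not constructed); the LINEARISATION of `𝒜_j` (R4 file 2 ∕ dag-n07-w1's `Node00/LinearisedAveragingShear`) and road R0′'s rows (r1)–(r3) are NOT here; BRIDGE-92-B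
stays GAP-STATED until they land; tokens ∕ stub 1 ∕ K0⁷ ∕ K1⁷ NOT closed; N07 NOT discharged (typed 28∕28 · discharged 5∕27 unmoved); no summit statement is proved by this seat; one
finite `T⁴` programme at fixed `ε`, Bałaban AS PRINTED with locators — the route closes the conditional finite-𝕋⁴ rung `BalabanLadder.UV` only; NOT continuum ∕ ℝ⁴ ∕ OS ∕ mass gap ∕
Clay.  No `sorry`, no `def`, no `instance`, no `notation`.
-/

noncomputable section

namespace Literature.MathematicalPhysics.QuantumFieldTheory.Balaban1983to89.Node00

open T4Continuum BlockAveraging BlockAveragingTwoLevel ExpMeanLog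
open GaugeField (gaugeAct)
open B16Sect1Backgrounds (toMS)

/-! ## §1  The printed `exp[mean log]` on `SU(N)` satisfies (0.5) and (0.6) on ALL families (the tree's total extension is `1` off the guard) -/

section TotalAxioms

open scoped Matrix.Norms.L2Operator

variable {n : Type*} [Fintype n] [DecidableEq n] [Nonempty n] {ι : Type*} [Fintype ι]

/-- **(0.5) for the tree's `ESU` on EVERY family**: `ESU{W_i⁻¹} = (ESU{W_i})⁻¹` — on the guard this is `ExpMeanLog.ESU_inv`; off the guard both sides are `1`, because the guard
`∀ i, ‖W_i − 1‖ < δ_N` is invariant under `W ↦ W⁻¹` (`‖W* − 1‖ = ‖W − 1‖`, `ExpMeanLog.norm_star_sub_one`). [cite: Balaban1987RG1, (0.5) p.253] -/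
theorem ESU_inv_total (W : ι → Matrix.specialUnitaryGroup n ℂ) : ESU (fun i => (W i)⁻¹) = (ESU W)⁻¹ := by
  by_cases h : ∀ i, ‖(W i : Matrix n n ℂ) - 1‖ < deltaSU n
  · exact ESU_inv h
  · have h' : ¬ ∀ i, ‖(((W i)⁻¹ : Matrix.specialUnitaryGroup n ℂ) : Matrix n n ℂ) - 1‖ < deltaSU n := fun h' => h fun i => by
      have hi := h' i
      have : (((W i)⁻¹ : Matrix.specialUnitaryGroup n ℂ) : Matrix n n ℂ) = star (W i : Matrix n n ℂ) := rfl
      rwa [this, norm_star_sub_one] at hi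
    rw [ESU_of_not_small h', ESU_of_not_small h, inv_one]

/-- **(0.6) (constant conjugations) for the tree's `ESU` on EVERY family**: `ESU{uW_iu⁻¹} = u·ESU{W_i}·u⁻¹` — on the guard `ExpMeanLog.ESU_conj`; off it both sides are `1`
(`‖uXu⁻¹ − 1‖ = ‖X − 1‖`, `ExpMeanLog.norm_conj_sub_one_eq`). [cite: Balaban1987RG1, (0.6) p.253] -/
theorem ESU_conj_total (W : ι → Matrix.specialUnitaryGroup n ℂ) (u : Matrix.specialUnitaryGroup n ℂ) :
    ESU (fun i => u * W i * u⁻¹) = u * ESU W * u⁻¹ := by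
  by_cases h : ∀ i, ‖(W i : Matrix n n ℂ) - 1‖ < deltaSU n
  · exact ESU_conj h u
  · have hu : (u : Matrix n n ℂ) ∈ Matrix.unitaryGroup n ℂ := (Matrix.mem_specialUnitaryGroup_iff.1 u.2).1
    have hu' : ((u⁻¹ : Matrix.specialUnitaryGroup n ℂ) : Matrix n n ℂ) ∈ Matrix.unitaryGroup n ℂ :=
      (Matrix.mem_specialUnitaryGroup_iff.1 (u⁻¹).2).1
    have hvw : (u : Matrix n n ℂ) * ((u⁻¹ : Matrix.specialUnitaryGroup n ℂ) : Matrix n n ℂ) = 1 := Unitary.mul_star_self_of_mem hu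
    have h' : ¬ ∀ i, ‖((u * W i * u⁻¹ : Matrix.specialUnitaryGroup n ℂ) : Matrix n n ℂ) - 1‖ < deltaSU n := fun h' => h fun i => by
      have hi := h' i
      have : ((u * W i * u⁻¹ : Matrix.specialUnitaryGroup n ℂ) : Matrix n n ℂ) =
          (u : Matrix n n ℂ) * (W i : Matrix n n ℂ) * ((u⁻¹ : Matrix.specialUnitaryGroup n ℂ) : Matrix n n ℂ) := rfl
      rwa [this, norm_conj_sub_one_eq hu hu' hvw] at hi
    rw [ESU_of_not_small h', ESU_of_not_small h, mul_one, mul_inv_cancel]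

variable [Nonempty ι]

/-- (0.5) for `expMeanLogSU.avg` over any nonempty finite index type, ALL families. [cite: Balaban1987RG1, (0.5) p.253] -/
theorem expMeanLogSU_avg_inv_total (W : ι → Matrix.specialUnitaryGroup n ℂ) :
    (expMeanLogSU (n := n)).avg (fun i => (W i)⁻¹) = ((expMeanLogSU (n := n)).avg W)⁻¹ :=
  ESU_inv_total (W ∘ (LoopAverage.enum ι).symm)

/-- (0.6) (constant conjugations) for `expMeanLogSU.avg` over any nonempty finite index type, ALL families. [cite: Balaban1987RG1, (0.6) p.253] -/
theorem expMeanLogSU_avg_conj_total (W : ι → Matrix.specialUnitaryGroup n ℂ) (u : Matrix.specialUnitaryGroup n ℂ) :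
    (expMeanLogSU (n := n)).avg (fun i => u * W i * u⁻¹) = u * (expMeanLogSU (n := n)).avg W * u⁻¹ :=
  ESU_conj_total (W ∘ (LoopAverage.enum ι).symm) u

end TotalAxioms

/-! ## §2  The hypotheses of `Node00.ShearedAveragingPureGauge` at the record's block operation and averaging -/

section BlockOpAxioms

variable {P : Params} (N : ℕ) [NeZero N]

/-- ★ **`hinv` for the (78) block operation of record, EVERY level, NO guard**: `𝓔_y{f⁻¹} = (𝓔_y{f})⁻¹` for `𝓔 := loopAvgBlockOp expMeanLogSU`.
[cite: Balaban1987RG1, (0.5) p.253; Balaban1985Averaging, (78) p.30] -/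
theorem loopAvgBlockOp_inv (i : ℕ) (y : Site P (i + 1)) (f : Site P i → SU N) :
    loopAvgBlockOp (expMeanLogSU (n := Fin N)) i y (fun x => (f x)⁻¹) = (loopAvgBlockOp (expMeanLogSU (n := Fin N)) i y f)⁻¹ := by
  unfold loopAvgBlockOp
  rw [← expMeanLogSU_avg_inv_total]
  congr 1
  funext r
  split_ifs <;> simp

/-- ★ **`hconj` for the (78) block operation of record, EVERY level, NO guard**: `𝓔_y{a·f·a⁻¹} = a·𝓔_y{f}·a⁻¹`.
[cite: Balaban1987RG1, (0.6) p.253; Balaban1985Averaging, (78) p.30] -/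
theorem loopAvgBlockOp_conj (i : ℕ) (y : Site P (i + 1)) (a : SU N) (f : Site P i → SU N) :
    loopAvgBlockOp (expMeanLogSU (n := Fin N)) i y (fun x => a * f x * a⁻¹) = a * loopAvgBlockOp (expMeanLogSU (n := Fin N)) i y f * a⁻¹ := by
  unfold loopAvgBlockOp
  rw [← expMeanLogSU_avg_conj_total]
  congr 1
  funext r
  split_ifs <;> simp

variable (F : T4Family)

/-- **`h1` at the record**: every averaging map of record fixes the unit configuration, `M(1) = 1` (`T3DescentFibreTower.avgFun_one` with `expMeanLogSU_E_one`; `rfl`-unfolding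
`Node00.avOfRecord_avg`).  The same one-liner is the Summits-side `Summit.QuantumFields.YangMills.BalabanUVNodes.N09OneDefectAveraging.avOfRecord_avg_one` (dag-n09 lane),
which a Literature file cannot import — restated here with this pointer. [cite: Balaban1987RG1, (0.4) p.253] -/
theorem avOfRecord_avg_one (K i : ℕ) : (avOfRecord F N K i).avg (1 : GaugeField (F.P K) i (SU N)) = 1 := by
  rw [avOfRecord_avg]
  exact T3DescentFibreTower.avgFun_one _ T3DescentFibreTower.expMeanLogSU_E_one

end BlockOpAxioms

/-! ## §3  THE RECORD INSTANCE of `Node00.ShearedAveragingPureGauge`, and road R0′'s naming row (r0) at the record -/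

section Instance

variable (F : T4Family) (N : ℕ) [NeZero N]

/-- ★★ **`S_j(1^g) = g↾T^{(j)}·(R̄ʲg)⁻¹` AT THE RECORD** (n07-e's `shearRIter_pureGauge` with its four hypotheses discharged: `avOfRecord_avg_one`, `holTo_contourOfRecord_one`,
`loopAvgBlockOp_inv`, `loopAvgBlockOp_conj`), every fine gauge function `g`, every `j ≤ m + K`. [cite: Balaban1985Averaging, (85) p.31] -/
theorem shearRIter_avOfRecord_pureGauge (K : ℕ) (g : GaugeTransf (F.P K) 0 (SU N)) {j : ℕ} (hj : j ≤ (F.P K).m + (F.P K).K) (y : Site (F.P K) j) :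
    shearRIter (avOfRecord F N K) (contourOfRecord F N K) (loopAvgBlockOp expMeanLogSU) (gaugeAct g 1) j y =
      toMS g j y * (gaugeAvgIter (loopAvgBlockOp expMeanLogSU) g j y)⁻¹ :=
  shearRIter_pureGauge _ _ _ (avOfRecord_avg_one N F K) (holTo_contourOfRecord_one F N K) (loopAvgBlockOp_inv N) (loopAvgBlockOp_conj N) g j hj y

/-- ★★★ **THE HINGE AT THE RECORD — `𝒜_j(1^g) = 1^{R̄ʲg}`**: for the averaging of record ((0.4), `exp[mean log]` on `SU(N)`), the contour datum of record ((0.11)) and the `exp[mean log]`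
block operation, the sheared `j`-fold average of a fine PURE GAUGE is the coarse pure gauge of the (79)–(80) `j`-fold BLOCK AVERAGE of the gauge function — EVERY `g`, every `j ≤ m + K`,
no smallness (the tree's total `exp[mean log]` satisfies (0.5)∕(0.6) on all families, §1). [cite: Balaban1985Averaging, (88) p.31, (79)–(80) p.30] -/
theorem shearedAvgIter_avOfRecord_pureGauge (K : ℕ) (g : GaugeTransf (F.P K) 0 (SU N)) {j : ℕ} (hj : j ≤ (F.P K).m + (F.P K).K) :
    shearedAvgIter (avOfRecord F N K) (contourOfRecord F N K) (loopAvgBlockOp expMeanLogSU) (gaugeAct g 1) j =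
      gaugeAct (gaugeAvgIter (loopAvgBlockOp expMeanLogSU) g j) (1 : GaugeField (F.P K) j (SU N)) :=
  shearedAvgIter_pureGauge _ _ _ (avOfRecord_avg_one N F K) (holTo_contourOfRecord_one F N K) (loopAvgBlockOp_inv N) (loopAvgBlockOp_conj N) g hj

/-- The one-step record instance: `𝒜(1^g) = 1^{R̄g}` at level `j → j+1` (`j + 1 ≤ m + K`). [cite: Balaban1985Averaging, (88) p.31, (78) p.30] -/
theorem shearedAvg_avOfRecord_pureGauge (K : ℕ) {j : ℕ} (hj : j + 1 ≤ (F.P K).m + (F.P K).K) (g : GaugeTransf (F.P K) j (SU N)) (c : PBond (F.P K) (j + 1)) :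
    shearedAvg (avOfRecord F N K j) (contourOfRecord F N K j) (loopAvgBlockOp expMeanLogSU j) (gaugeAct g 1) c =
      gaugeAct (gaugeAvgF (loopAvgBlockOp expMeanLogSU j) g) (1 : GaugeField (F.P K) (j + 1) (SU N)) c :=
  shearedAvg_pureGauge _ _ _ hj (avOfRecord_avg_one N F K j) (holTo_contourOfRecord_one F N K j) (loopAvgBlockOp_inv N j) (loopAvgBlockOp_conj N j) g c

/-- ★★ **ROAD R0′'s NAMING ROW (r0) AT THE RECORD** (plan g83 WORDS-2): under the block axial gauges of `M^i(U′)`, `i < j ≤ m + K`, `U′ = U₁^u`, for the contour datum of record, and the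
(81)∕(1.29) normalisation `R̄ʲu = 1` at both ends of the bond `c` of `T^{(j)}`, the PLAIN `j`-fold average of record of the Landau copy is the average of record of `U′` re-gauged by the
INTRINSIC coarse gauge transformation `S_j(U₁)`: `M^j(U₁)(c) = S_j(c₋)·M^j(U′)(c)·S_j(c₊)⁻¹` — the shear of road R0 named without reference to `u` (n07-e's `iter_eq_gaugeAct_shearRIter`,
`h𝓔`∕`hctr` discharged). [cite: Balaban1985Averaging, (85)–(88) p.31; Balaban1985Variational, (154) p.302] -/
theorem iter_avOfRecord_eq_gaugeAct_shearRIter (K : ℕ) {u : GaugeTransf (F.P K) 0 (SU N)} {U₁ : GaugeField (F.P K) 0 (SU N)} {j : ℕ}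
    (hj : j ≤ (F.P K).m + (F.P K).K)
    (hax : ∀ i < j, AxialGauge (contourOfRecord F N K i) (Averaging.iter (avOfRecord F N K) i (gaugeAct u U₁)))
    {c : PBond (F.P K) j} (hsrc : gaugeAvgIter (loopAvgBlockOp expMeanLogSU) u j c.src = 1)
    (htgt : gaugeAvgIter (loopAvgBlockOp expMeanLogSU) u j c.tgt = 1) :
    Averaging.iter (avOfRecord F N K) j U₁ c =
      gaugeAct (shearRIter (avOfRecord F N K) (contourOfRecord F N K) (loopAvgBlockOp expMeanLogSU) U₁ j)
        (Averaging.iter (avOfRecord F N K) j (gaugeAct u U₁)) c :=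
  iter_eq_gaugeAct_shearRIter _ _ _ (loopAvgBlockOp_local expMeanLogSU) (holTo_contourOfRecord_emb F N K) hj hax hsrc htgt

/-- ★ **(87) AT THE RECORD — the centre values of the re-gauging `u` are INTRINSIC**: under the block axial gauges of `M^i(U′)`, `i < j ≤ m + K`, for the contour datum of record and the
(81)∕(1.29) normalisation `R̄ʲu(y) = 1` at the site `y` of `T^{(j)}`, `u↾T^{(j)}(y) = S_j(U₁)(y)⁻¹` (n07-e's `toMS_eq_shearRIter_inv` with `h𝓔`∕`hctr` discharged at `loopAvgBlockOp expMeanLogSU` ∕ `contourOfRecord`).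
[cite: Balaban1985Averaging, (87) p.31; Balaban1985Variational, (152) p.301] -/
theorem toMS_eq_shearRIter_avOfRecord_inv (K : ℕ) {u : GaugeTransf (F.P K) 0 (SU N)} {U₁ : GaugeField (F.P K) 0 (SU N)} {j : ℕ}
    (hj : j ≤ (F.P K).m + (F.P K).K)
    (hax : ∀ i < j, AxialGauge (contourOfRecord F N K i) (Averaging.iter (avOfRecord F N K) i (gaugeAct u U₁)))
    {y : Site (F.P K) j} (h81 : gaugeAvgIter (loopAvgBlockOp expMeanLogSU) u j y = 1) :
    toMS u j y = (shearRIter (avOfRecord F N K) (contourOfRecord F N K) (loopAvgBlockOp expMeanLogSU) U₁ j y)⁻¹ :=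
  toMS_eq_shearRIter_inv _ _ _ (loopAvgBlockOp_local expMeanLogSU) (holTo_contourOfRecord_emb F N K) hj hax h81

open scoped Matrix.Norms.L2Operator in
/-- **(r0) in the record's logarithm letters — «`λ_j = log(u∘emb) = −log S_j(U₁)`»**: at a normalised site the principal logarithm (`MatrixLog.mlog`, the `(1∕i) log` of [B11] (152)∕(155) up to the
factor `i`) of the centre value of `u` is that of `S_j(U₁)(y)* = S_j(U₁)(y)⁻¹` — road R0′'s coarse gauge exponent read from `U₁` alone. [cite: Balaban1985Variational, (152) p.301; Balaban1985Averaging, (87) p.31] -/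
theorem mlog_toMS_eq_mlog_star_shearRIter (K : ℕ) {u : GaugeTransf (F.P K) 0 (SU N)} {U₁ : GaugeField (F.P K) 0 (SU N)} {j : ℕ}
    (hj : j ≤ (F.P K).m + (F.P K).K)
    (hax : ∀ i < j, AxialGauge (contourOfRecord F N K i) (Averaging.iter (avOfRecord F N K) i (gaugeAct u U₁)))
    {y : Site (F.P K) j} (h81 : gaugeAvgIter (loopAvgBlockOp expMeanLogSU) u j y = 1) :
    MatrixLog.mlog ((toMS u j y : SU N) : Matrix (Fin N) (Fin N) ℂ) =
      MatrixLog.mlog (star ((shearRIter (avOfRecord F N K) (contourOfRecord F N K) (loopAvgBlockOp expMeanLogSU) U₁ j y : SU N) : Matrix (Fin N) (Fin N) ℂ)) := by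
  rw [toMS_eq_shearRIter_avOfRecord_inv F N K hj hax h81]
  rfl

/-- **(r0) with the constraint datum displayed**: `M^j(U′)(c) = V″(c)` ⇒ `M^j(U₁)(c) = S_j(c₋)·V″(c)·S_j(c₊)⁻¹` — road R0′'s sheared datum `V‴ = V″^{S_j(U₁)}` at the record.
[cite: Balaban1985Variational, (154)–(156) p.302] -/
theorem iter_avOfRecord_eq_gaugeAct_shearRIter_data (K : ℕ) {u : GaugeTransf (F.P K) 0 (SU N)} {U₁ : GaugeField (F.P K) 0 (SU N)} {j : ℕ}
    (hj : j ≤ (F.P K).m + (F.P K).K)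
    (hax : ∀ i < j, AxialGauge (contourOfRecord F N K i) (Averaging.iter (avOfRecord F N K) i (gaugeAct u U₁)))
    {V : GaugeField (F.P K) j (SU N)} {c : PBond (F.P K) j} (hV : Averaging.iter (avOfRecord F N K) j (gaugeAct u U₁) c = V c)
    (hsrc : gaugeAvgIter (loopAvgBlockOp expMeanLogSU) u j c.src = 1) (htgt : gaugeAvgIter (loopAvgBlockOp expMeanLogSU) u j c.tgt = 1) :
    Averaging.iter (avOfRecord F N K) j U₁ c =
      shearRIter (avOfRecord F N K) (contourOfRecord F N K) (loopAvgBlockOp expMeanLogSU) U₁ j c.src * V c *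
        (shearRIter (avOfRecord F N K) (contourOfRecord F N K) (loopAvgBlockOp expMeanLogSU) U₁ j c.tgt)⁻¹ :=
  iter_eq_gaugeAct_shearRIter_data _ _ _ (loopAvgBlockOp_local expMeanLogSU) (holTo_contourOfRecord_emb F N K) hj hax hV hsrc htgt

/-- **(r0) on the `Λ_j`-bonds of the torus tower of a cube datum** (`Node00.cubeDomains`, module 39): (1.29) on the `Λ_j`-sites + block axial gauges below `j` + the (150) constraint at a
`Λ_j`-bond ⇒ `M^j(U₁)(c) = S_j(c₋)·V″(c)·S_j(c₊)⁻¹` there. [cite: Balaban1985Variational, (154)–(156) p.302; Balaban1985RegularSpaces, (1.131) p.99] -/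
theorem iter_avOfRecord_eq_gaugeAct_shearRIter_cubeDomains (K : ℕ) {a : Fin (F.P K).d → ℤ} {M ρ k : ℕ} (hk : k ≤ (F.P K).m + (F.P K).K)
    {u : GaugeTransf (F.P K) 0 (SU N)} {U₁ : GaugeField (F.P K) 0 (SU N)} {j : ℕ} (hjk : j ≤ k)
    (hax : ∀ i < j, AxialGauge (contourOfRecord F N K i) (Averaging.iter (avOfRecord F N K) i (gaugeAct u U₁)))
    (h129 : ∀ y : Site (F.P K) j, (cubeDomains (F.P K) a M ρ k hk).LamSite j y → gaugeAvgIter (loopAvgBlockOp expMeanLogSU) u j y = 1)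
    {V : GaugeField (F.P K) j (SU N)} {c : PBond (F.P K) j}
    (hs : (cubeDomains (F.P K) a M ρ k hk).LamSite j c.src) (ht : (cubeDomains (F.P K) a M ρ k hk).LamSite j c.tgt)
    (hV : Averaging.iter (avOfRecord F N K) j (gaugeAct u U₁) c = V c) :
    Averaging.iter (avOfRecord F N K) j U₁ c =
      shearRIter (avOfRecord F N K) (contourOfRecord F N K) (loopAvgBlockOp expMeanLogSU) U₁ j c.src * V c *
        (shearRIter (avOfRecord F N K) (contourOfRecord F N K) (loopAvgBlockOp expMeanLogSU) U₁ j c.tgt)⁻¹ :=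
  iter_avOfRecord_eq_gaugeAct_shearRIter_data F N K (hjk.trans hk) hax hV (h129 _ hs) (h129 _ ht)

/-- **A6 NON-VACUITY of the hinge at the record**: at `g = 1` both sides of `shearedAvgIter_avOfRecord_pureGauge` are the unit configuration (`1^1 = 1`, `R̄ʲ1 = 1`).
[cite: Balaban1985Averaging, (88) p.31] -/
theorem shearedAvgIter_avOfRecord_pureGauge_one (K j : ℕ) :
    shearedAvgIter (avOfRecord F N K) (contourOfRecord F N K) (loopAvgBlockOp expMeanLogSU)
        (gaugeAct (fun _ => (1 : SU N)) (1 : GaugeField (F.P K) 0 (SU N))) j = 1 ∧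
      gaugeAct (gaugeAvgIter (P := F.P K) (loopAvgBlockOp expMeanLogSU) (fun _ => (1 : SU N)) j) (1 : GaugeField (F.P K) j (SU N)) = 1 := by
  refine ⟨?_, ?_⟩
  · rw [B12RTGaugeInvariance254.gaugeAct_one']
    exact shearedAvgIter_avOfRecord_one F N K j
  · rw [gaugeAvgIter_loopAvgBlockOp_one (P := F.P K) expMeanLogSU (expMeanLogSU_E_one' N) j]
    exact B12RTGaugeInvariance254.gaugeAct_one' _

end Instance

end Literature.MathematicalPhysics.QuantumFieldTheory.Balaban1983to89.Node00
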